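import Summits.ResolutionOfSingularities.ResolutionOfSingularities.Theorems.FrobeniusLadderFInjectiveMacaulayficationE8Forms
import Mathlib.RingTheory.MvPolynomial.WeightedHomogeneous
import Mathlib.Algebra.MvPolynomial.PDeriv
import Mathlib.Algebra.MvPolynomial.Equiv
import Mathlib.Algebra.Polynomial.Degree.Domain
import Mathlib.RingTheory.Polynomial.UniqueFactorization
import Mathlib.RingTheory.Ideal.Quotient.Operations
import Mathlib.Algebra.BigOperators.Fin
import Mathlib.Tactic.LinearCombination
import HarnessLib

/-!
# The threefold point `h = X₂² + X₃²(X₁⁶ + X₀³) + X₀²X₃³` as a `(2,1,5,2)`-weighted specimen: characteristic-free data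
# (crux `FInjectiveMacaulayfication`, line `graded-engine` §16, calibration G6c)

Support file for crux stmt-ResolutionOfSingularities-15315 (`FrobeniusLadder.FInjectiveMacaulayfication`), chain w45a,
seat res-L1-w45a-stub-3. [OURS · L1 W4.5a, CRUX-PLAN v3 §C, calibration G6c] — NOT a statement of the manuscript;
AI-written, weaker than expert review.

The hypersurface `h = X₂² + X₃²(X₁⁶ + X₀³) + X₀²X₃³ ⊂ 𝔸⁴` (tri-2's wild specimen: at `p = 5` the weight `w₂ = 5 = p`
makes the μ-cover of the §15 engine wild, and its singular locus `{X₂ = X₃ = 0} ∪ {X₀ = X₁ = X₂ = 0}` is NOT isolated —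
the first non-isolated calibration of the graded engine G4/G5, tri-1 F4 / tri-2 F10) is weighted-homogeneous for
`w = (2, 1, 5, 2)` of weight `D = 10`; with `N = 10` and cover exponents `c = (5, 10, 2, 5)` the graded engine
G5 `stub_gradedConeFiModel` consumes the following specimen data, all CHARACTERISTIC-FREE and proved here:

* `h_isWeightedHomogeneous` — weighted homogeneity of weight `10`;
* `hVeroneseSplitting` — VERONESE SATURATION for `(2,1,5,2)` and `N = 10` (it HOLDS for the least candidate `N = lcm = 10`;
  contrast BP(2,3,7) where `N = 42` fails and `84` is needed): a monomial of weighted degree `≥ 10(K+1)` splits off a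
  monomial of weight EXACTLY `10` — peel `X₂²`, `X₀⁵`, `X₃⁵`, `X₁¹⁰`, or `X₀^a X₃^(5-a)` when `a₀ + a₃ ≥ 5`, and in the
  remaining box (`a₂ ≤ 1`, `a₀ + a₃ ≤ 4`, `a₁ ≤ 9`, weight `≤ 22`) a positive `K` forces `a₂ = 1`, `a₁ ≥ 7`, so `X₁⁵X₂` peels;
* `prime_h` — `h` is prime over EVERY field and divides no variable: `k[X₀,…,X₃] ≃ k[Y₀,Y₁,Y₂][T]`, `X₂ ↦ T`,
  `h ↦ T² + c`, and `-c` is not a square because an evaluation of `c` has ODD degree (`mul_self_ne_neg_of_odd_natDegree`,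
  the odd-degree test of `E8Forms` for any number of variables: `c(0, T, 1) = T³ + T²`);
* `h_X_ne_zero` — no variable vanishes modulo `h`;
* `pderiv_zero_h`, `pderiv_one_h`, `pderiv_two_h` — the partials used by the Jacobian discharger at the regular points
  off the origin (`∂₀h = X₀X₃²(3X₀ + 2X₃)`, `∂₁h = 6X₁⁵X₃²`, `∂₂h = 2X₂`).

The `p = 5` off-origin clause along the singular locus (Fedder at arbitrary closed points) and the model modulo G5 are in
the companion files `…HFedderCertificates` / `…HGradedFiModel`. All proofs are glue on Mathlib; no definitions, no named
facts. [folklore]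
-/

-- single-problem summit: the doubled namespace component is forced
set_option linter.dupNamespace false

noncomputable section

namespace Summit.ResolutionOfSingularities.ResolutionOfSingularities.Theorems.FInjectiveMacaulayfication.HWeightedData

open MvPolynomial
open Summit.ResolutionOfSingularities.ResolutionOfSingularities.Theorems.FInjectiveMacaulayfication

/-! ## Weighted homogeneity -/

/-- The `(2,1,5,2)`-weighted degree of an exponent vector `a : Fin 4 →₀ ℕ` in coordinates:
`weight ![2,1,5,2] a = 2a₀ + a₁ + 5a₂ + 2a₃`. [folklore] -/
theorem weight_eq (a : Fin 4 →₀ ℕ) :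
    Finsupp.weight (![2, 1, 5, 2] : Fin 4 → ℕ) a = 2 * a 0 + a 1 + 5 * a 2 + 2 * a 3 := by
  rw [Finsupp.weight_apply,
    Finsupp.sum_fintype a (fun i c => c • (![2, 1, 5, 2] : Fin 4 → ℕ) i) (fun _ => zero_smul ℕ _),
    Fin.sum_univ_four]
  simp only [smul_eq_mul, Matrix.cons_val_zero, Matrix.cons_val_one, Matrix.cons_val]
  ring

/-- **`h = X₂² + X₃²(X₁⁶ + X₀³) + X₀²X₃³` is weighted-homogeneous of weight `10` for the weights `(2,1,5,2)`**
(`X₂²`: `2·5`; `X₃²X₁⁶`: `4 + 6`; `X₃²X₀³`: `4 + 6`; `X₀²X₃³`: `4 + 6`). [folklore] -/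
theorem h_isWeightedHomogeneous (k : Type) [Field k] :
    MvPolynomial.IsWeightedHomogeneous (![2, 1, 5, 2] : Fin 4 → ℕ)
      (X 2 ^ 2 + X 3 ^ 2 * (X 1 ^ 6 + X 0 ^ 3) + X 0 ^ 2 * X 3 ^ 3 : MvPolynomial (Fin 4) k) 10 := by
  have hX := fun j : Fin 4 => isWeightedHomogeneous_X k (![2, 1, 5, 2] : Fin 4 → ℕ) j
  refine ((?_ : IsWeightedHomogeneous _ _ 10).add ?_).add ?_
  · simpa using (hX 2).pow 2
  · have h3 : IsWeightedHomogeneous (![2, 1, 5, 2] : Fin 4 → ℕ) (X 3 ^ 2 : MvPolynomial (Fin 4) k) 4 := by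
      simpa using (hX 3).pow 2
    have h10 : IsWeightedHomogeneous (![2, 1, 5, 2] : Fin 4 → ℕ)
        (X 1 ^ 6 + X 0 ^ 3 : MvPolynomial (Fin 4) k) 6 := by
      refine IsWeightedHomogeneous.add ?_ ?_
      · simpa using (hX 1).pow 6
      · simpa using (hX 0).pow 3
    simpa using h3.mul h10
  · have h0 : IsWeightedHomogeneous (![2, 1, 5, 2] : Fin 4 → ℕ) (X 0 ^ 2 : MvPolynomial (Fin 4) k) 4 := by
      simpa using (hX 0).pow 2
    have h3 : IsWeightedHomogeneous (![2, 1, 5, 2] : Fin 4 → ℕ) (X 3 ^ 3 : MvPolynomial (Fin 4) k) 6 := by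
      simpa using (hX 3).pow 3
    simpa using h0.mul h3

/-! ## Veronese saturation for `(2,1,5,2)`, `N = 10` -/

/-- **Coordinate splitting** for `w = (2,1,5,2)`, `N = 10`: if `(K+1)·10 ≤ 2a₀ + a₁ + 5a₂ + 2a₃` then `a = b + c` with
`10 ≤ w·b` and `K·10 ≤ w·c`. A monomial of weight EXACTLY `10` always peels: `X₂²`, `X₀⁵`, `X₃⁵`, `X₁¹⁰`, `X₀^a₀ X₃^(5-a₀)`
(when `a₀ + a₃ ≥ 5`), and in the remaining box a positive `K` forces `a₂ = 1`, `a₁ ≥ 7`, so `X₁⁵X₂` peels. [folklore] -/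
theorem coord_split (K a₀ a₁ a₂ a₃ : ℕ) (h : (K + 1) * 10 ≤ 2 * a₀ + a₁ + 5 * a₂ + 2 * a₃) :
    ∃ b₀ b₁ b₂ b₃ c₀ c₁ c₂ c₃ : ℕ, a₀ = b₀ + c₀ ∧ a₁ = b₁ + c₁ ∧ a₂ = b₂ + c₂ ∧ a₃ = b₃ + c₃ ∧
      10 ≤ 2 * b₀ + b₁ + 5 * b₂ + 2 * b₃ ∧ K * 10 ≤ 2 * c₀ + c₁ + 5 * c₂ + 2 * c₃ := by
  by_cases h₂ : 2 ≤ a₂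
  · exact ⟨0, 0, 2, 0, a₀, a₁, a₂ - 2, a₃, by omega⟩
  by_cases h₀ : 5 ≤ a₀
  · exact ⟨5, 0, 0, 0, a₀ - 5, a₁, a₂, a₃, by omega⟩
  by_cases h₃ : 5 ≤ a₃
  · exact ⟨0, 0, 0, 5, a₀, a₁, a₂, a₃ - 5, by omega⟩
  by_cases h₁ : 10 ≤ a₁
  · exact ⟨0, 10, 0, 0, a₀, a₁ - 10, a₂, a₃, by omega⟩
  by_cases h₀₃ : 5 ≤ a₀ + a₃
  · exact ⟨a₀, 0, 0, 5 - a₀, 0, a₁, a₂, a₃ - (5 - a₀), by omega⟩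
  rcases Nat.eq_zero_or_pos K with rfl | hK
  · exact ⟨a₀, a₁, a₂, a₃, 0, 0, 0, 0, by omega⟩
  · -- `K ≥ 1` in the box with `a₀ + a₃ ≤ 4`: then `a₂ = 1` and `a₁ ≥ 7`; peel `X₁⁵ X₂`
    exact ⟨0, 5, 1, 0, a₀, a₁ - 5, a₂ - 1, a₃, by omega⟩

/-- **Exponent-vector splitting** (`coord_split` along `Finsupp.equivFunOnFinite`). [folklore] -/
theorem finsupp_split (K : ℕ) (a : Fin 4 →₀ ℕ)
    (ha : (K + 1) * 10 ≤ Finsupp.weight (![2, 1, 5, 2] : Fin 4 → ℕ) a) :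
    ∃ b c : Fin 4 →₀ ℕ, a = b + c ∧ 10 ≤ Finsupp.weight (![2, 1, 5, 2] : Fin 4 → ℕ) b ∧
      K * 10 ≤ Finsupp.weight (![2, 1, 5, 2] : Fin 4 → ℕ) c := by
  rw [weight_eq] at ha
  obtain ⟨b₀, b₁, b₂, b₃, c₀, c₁, c₂, c₃, e₀, e₁, e₂, e₃, hb, hc⟩ := coord_split K (a 0) (a 1) (a 2) (a 3) ha
  refine ⟨Finsupp.equivFunOnFinite.symm ![b₀, b₁, b₂, b₃], Finsupp.equivFunOnFinite.symm ![c₀, c₁, c₂, c₃],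
    ?_, ?_, ?_⟩
  · ext i
    fin_cases i <;> simp [e₀, e₁, e₂, e₃]
  · rw [weight_eq]
    simpa using hb
  · rw [weight_eq]
    simpa using hc

/-- **VERONESE SATURATION for the weights `(2,1,5,2)` and `N = 10`** (the `hpow` hypothesis of the weighted / graded
blow-up engines for `h`): every monomial of weighted degree `≥ 10K` lies in `I₁₀^K`, `I₁₀` the ideal spanned by the monomials
of weighted degree `≥ 10`. It holds for the least candidate `N = 10`. [folklore] -/
theorem hVeroneseSplitting : ∀ (k : Type) [Field k] (K : ℕ) (a : Fin 4 →₀ ℕ),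
    K * 10 ≤ Finsupp.weight (![2, 1, 5, 2] : Fin 4 → ℕ) a →
    (MvPolynomial.monomial a (1 : k) : MvPolynomial (Fin 4) k) ∈
      (Ideal.span {m : MvPolynomial (Fin 4) k | ∃ b : Fin 4 →₀ ℕ,
        10 ≤ Finsupp.weight (![2, 1, 5, 2] : Fin 4 → ℕ) b ∧ m = MvPolynomial.monomial b 1}) ^ K := by
  intro k _ K
  induction K with
  | zero =>
    intro a _
    rw [pow_zero, Ideal.one_eq_top]
    exact Submodule.mem_top
  | succ K ih =>
    intro a ha
    obtain ⟨b, c, rfl, hb, hc⟩ := finsupp_split K a ha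
    have hmul : (MvPolynomial.monomial (b + c) (1 : k) : MvPolynomial (Fin 4) k) =
        MvPolynomial.monomial b 1 * MvPolynomial.monomial c 1 := by
      rw [MvPolynomial.monomial_mul, one_mul]
    rw [pow_succ', hmul]
    exact Ideal.mul_mem_mul (Ideal.subset_span ⟨b, hb, rfl⟩) (ih c hc)

/-! ## Primality over every field -/

/-- **Odd-degree test for non-squares** (any number of variables; cf. `E8Forms.mul_self_ne_neg_of_aeval`): if some
evaluation `k[X_σ] → k[T]` sends `c` to a polynomial of ODD degree, then `-c` is not a square — a square root would
evaluate to `b` with `deg (b·b) = 2 deg b` even. [folklore] -/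
theorem mul_self_ne_neg_of_odd_natDegree {k : Type} [Field k] {σ : Type*} {c : MvPolynomial σ k}
    (v : σ → Polynomial k) (hv : Odd (MvPolynomial.aeval v c).natDegree) (a : MvPolynomial σ k) :
    a * a ≠ -c := by
  intro h
  have h2 : MvPolynomial.aeval v a * MvPolynomial.aeval v a = -MvPolynomial.aeval v c := by
    rw [← map_mul, h, map_neg]
  by_cases ha : MvPolynomial.aeval v a = 0
  · rw [ha, zero_mul, eq_comm, neg_eq_zero] at h2
    rw [h2, Polynomial.natDegree_zero] at hv
    have h4 := Nat.odd_iff.mp hv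
    omega
  · have h3 := congrArg Polynomial.natDegree h2
    rw [Polynomial.natDegree_mul ha ha, Polynomial.natDegree_neg] at h3
    have h4 := Nat.odd_iff.mp hv
    omega

/-- **`h = X₂² + X₃²(X₁⁶ + X₀³) + X₀²X₃³` is prime over every field and divides no variable.** Identify
`k[X₀,…,X₃]` with `k[Y₀,Y₁,Y₂][T]` (`X₂ ↦ T`, `X₀ ↦ C Y₁`, `X₁ ↦ C Y₀`, `X₃ ↦ C Y₂`: `renameEquiv (swap 0 2)` then
`finSuccEquiv`); `h ↦ T² + c`, `c = Y₂²(Y₀⁶ + Y₁³) + Y₁²Y₂³`, and `c(0, T, 1) = T³ + T²` has odd degree, so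
`E8Forms.prime_and_not_dvd_of_ringEquiv` applies; `X₀, X₁, X₃` go to non-zero constants and `h ∤ X₂` by degree.
[folklore] -/
theorem prime_h (k : Type) [Field k] (h : MvPolynomial (Fin 4) k)
    (hh : h = X 2 ^ 2 + X 3 ^ 2 * (X 1 ^ 6 + X 0 ^ 3) + X 0 ^ 2 * X 3 ^ 3) :
    Prime h ∧ ∀ v : Fin 4, ¬ h ∣ MvPolynomial.X v := by
  obtain ⟨e, he0, he1, he2, he3⟩ : ∃ e : MvPolynomial (Fin 4) k ≃+* Polynomial (MvPolynomial (Fin 3) k),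
      e (X 0) = Polynomial.C (X 1) ∧ e (X 1) = Polynomial.C (X 0) ∧ e (X 2) = Polynomial.X ∧
        e (X 3) = Polynomial.C (X 2) := by
    refine ⟨((renameEquiv k (Equiv.swap (0 : Fin 4) 2)).trans (finSuccEquiv k 3)).toRingEquiv, ?_, ?_, ?_, ?_⟩
    · show finSuccEquiv k 3 (rename (Equiv.swap (0 : Fin 4) 2) (X 0)) = _
      rw [rename_X, Equiv.swap_apply_left]
      exact finSuccEquiv_X_succ (j := 1)
    · show finSuccEquiv k 3 (rename (Equiv.swap (0 : Fin 4) 2) (X 1)) = _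
      rw [rename_X, Equiv.swap_apply_of_ne_of_ne (by decide) (by decide)]
      exact finSuccEquiv_X_succ (j := 0)
    · show finSuccEquiv k 3 (rename (Equiv.swap (0 : Fin 4) 2) (X 2)) = _
      rw [rename_X, Equiv.swap_apply_right]
      exact finSuccEquiv_X_zero
    · show finSuccEquiv k 3 (rename (Equiv.swap (0 : Fin 4) 2) (X 3)) = _
      rw [rename_X, Equiv.swap_apply_of_ne_of_ne (by decide) (by decide)]
      exact finSuccEquiv_X_succ (j := 2)
  have hef : e h = Polynomial.X ^ 2 +
      Polynomial.C (X 2 ^ 2 * (X 0 ^ 6 + X 1 ^ 3) + X 1 ^ 2 * X 2 ^ 3 : MvPolynomial (Fin 3) k) := by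
    subst hh
    simp only [map_add, map_mul, map_pow, he0, he1, he2, he3]
    ring
  have hc : ∀ a : MvPolynomial (Fin 3) k, a * a ≠ -(X 2 ^ 2 * (X 0 ^ 6 + X 1 ^ 3) + X 1 ^ 2 * X 2 ^ 3) := by
    refine mul_self_ne_neg_of_odd_natDegree ![0, Polynomial.X, 1] ?_
    have hv : MvPolynomial.aeval (![0, Polynomial.X, 1] : Fin 3 → Polynomial k)
        (X 2 ^ 2 * (X 0 ^ 6 + X 1 ^ 3) + X 1 ^ 2 * X 2 ^ 3 : MvPolynomial (Fin 3) k) =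
        Polynomial.X ^ 3 + Polynomial.X ^ 2 := by
      simp only [map_add, map_mul, map_pow, MvPolynomial.aeval_X, Matrix.cons_val_zero, Matrix.cons_val_one,
        Matrix.cons_val]
      ring
    rw [hv, Polynomial.natDegree_add_eq_left_of_natDegree_lt] <;>
      simp only [Polynomial.natDegree_X_pow]
    · decide
    · norm_num
  obtain ⟨hp, hnd⟩ := E8Forms.prime_and_not_dvd_of_ringEquiv e h _ hef hc
  refine ⟨hp, fun v => ?_⟩
  fin_cases v
  · exact hnd (X 0) (X 1) (X_ne_zero 1) he0
  · exact hnd (X 1) (X 0) (X_ne_zero 0) he1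
  · rintro ⟨q, hq⟩
    have h1 : (Polynomial.X ^ 2 + Polynomial.C (X 2 ^ 2 * (X 0 ^ 6 + X 1 ^ 3) + X 1 ^ 2 * X 2 ^ 3) :
        Polynomial (MvPolynomial (Fin 3) k)) ∣ Polynomial.X :=
      ⟨e q, by rw [← hef, ← map_mul, ← hq]; exact he2.symm⟩
    have h2 := Polynomial.natDegree_le_of_dvd h1 Polynomial.X_ne_zero
    rw [Polynomial.natDegree_X_pow_add_C, Polynomial.natDegree_X] at h2
    omega
  · exact hnd (X 3) (X 2) (X_ne_zero 2) he3

/-- `(h)` is a prime ideal. [folklore] -/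
theorem span_h_isPrime (k : Type) [Field k] (h : MvPolynomial (Fin 4) k)
    (hh : h = X 2 ^ 2 + X 3 ^ 2 * (X 1 ^ 6 + X 0 ^ 3) + X 0 ^ 2 * X 3 ^ 3) : (Ideal.span {h}).IsPrime :=
  (Ideal.span_singleton_prime (prime_h k h hh).1.ne_zero).mpr (prime_h k h hh).1

/-- No variable lies in `(h)`. [folklore] -/
theorem h_X_ne_zero (k : Type) [Field k] (h : MvPolynomial (Fin 4) k)
    (hh : h = X 2 ^ 2 + X 3 ^ 2 * (X 1 ^ 6 + X 0 ^ 3) + X 0 ^ 2 * X 3 ^ 3) (v : Fin 4) :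
    Ideal.Quotient.mk (Ideal.span {h}) (MvPolynomial.X v) ≠ 0 := fun h0 =>
  (prime_h k h hh).2 v (Ideal.mem_span_singleton.mp (Ideal.Quotient.eq_zero_iff_mem.mp h0))

/-! ## Partial derivatives -/

/-- `∂₀ h = X₀X₃²(3X₀ + 2X₃)`. [folklore] -/
theorem pderiv_zero_h {A : Type*} [CommRing A] :
    pderiv 0 (X 2 ^ 2 + X 3 ^ 2 * (X 1 ^ 6 + X 0 ^ 3) + X 0 ^ 2 * X 3 ^ 3 : MvPolynomial (Fin 4) A) =
      X 0 * X 3 ^ 2 * (3 * X 0 + 2 * X 3) := by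
  simp only [map_add, pderiv_mul, pderiv_pow, pderiv_X_self,
    pderiv_X_of_ne (show (1 : Fin 4) ≠ 0 by decide), pderiv_X_of_ne (show (2 : Fin 4) ≠ 0 by decide),
    pderiv_X_of_ne (show (3 : Fin 4) ≠ 0 by decide)]
  norm_num
  ring

/-- `∂₁ h = 6X₁⁵X₃²`. [folklore] -/
theorem pderiv_one_h {A : Type*} [CommRing A] :
    pderiv 1 (X 2 ^ 2 + X 3 ^ 2 * (X 1 ^ 6 + X 0 ^ 3) + X 0 ^ 2 * X 3 ^ 3 : MvPolynomial (Fin 4) A) =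
      6 * X 1 ^ 5 * X 3 ^ 2 := by
  simp only [map_add, pderiv_mul, pderiv_pow, pderiv_X_self,
    pderiv_X_of_ne (show (0 : Fin 4) ≠ 1 by decide), pderiv_X_of_ne (show (2 : Fin 4) ≠ 1 by decide),
    pderiv_X_of_ne (show (3 : Fin 4) ≠ 1 by decide)]
  norm_num
  ring

/-- `∂₂ h = 2X₂`. [folklore] -/
theorem pderiv_two_h {A : Type*} [CommRing A] :
    pderiv 2 (X 2 ^ 2 + X 3 ^ 2 * (X 1 ^ 6 + X 0 ^ 3) + X 0 ^ 2 * X 3 ^ 3 : MvPolynomial (Fin 4) A) =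
      2 * X 2 := by
  simp only [map_add, pderiv_mul, pderiv_pow, pderiv_X_self,
    pderiv_X_of_ne (show (0 : Fin 4) ≠ 2 by decide), pderiv_X_of_ne (show (1 : Fin 4) ≠ 2 by decide),
    pderiv_X_of_ne (show (3 : Fin 4) ≠ 2 by decide)]
  norm_num

end Summit.ResolutionOfSingularities.ResolutionOfSingularities.Theorems.FInjectiveMacaulayfication.HWeightedData

end
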